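import Summits.ABC.ABC.Theorems.TwistAmplificationSharpModerateLawCoreInverseDictionary
import Summits.ABC.ABC.Theorems.TwistAmplificationSharpModerateLawCoreTransferResidues

/-!
# Crux `TwistAmplification.SharpModerateLaw` (stmt-ABC-1975): the two Szpiro-robust cores are equivalent

Support file (`--supports stmt-ABC-1975`, line `unit-plane-conic-two-torsion`, stub `stub_ringCensus`, wave 2;
the stub itself stays open).  The lead's canonical cores `CoreLaw` (cusp side) and `CoreLawIF` (index-form side)
of `…SharpModerateLawCoreDefs.lean` are EQUIVALENT: `coreLawIF_of_coreLaw` (the inverse dictionary,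
`…CoreInverseDictionary.lean`) and `coreLaw_of_coreLawIF` (the dictionary, `…CoreTransferResidues.lean`).
-/

noncomputable section

-- the mandated summit namespace `Summit.ABC.ABC` (summit = problem) trips the duplicate-namespace linter
set_option linter.dupNamespace false

namespace Summit.ABC.ABC.Theorems.SharpModerateLaw

/-- **`CoreLaw ↔ CoreLawIF`** (registered sub-goal of stmt-ABC-1975): the Szpiro-robust cusp core and the
Szpiro-robust index-form core of the crux are equivalent (`coreLawIF_of_coreLaw`, `coreLaw_of_coreLawIF`). -/
theorem coreLaw_iff_coreLawIF : CoreLaw ↔ CoreLawIF :=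
  ⟨coreLawIF_of_coreLaw, coreLaw_of_coreLawIF⟩

end Summit.ABC.ABC.Theorems.SharpModerateLaw

end
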